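import Literature.Analysis.FunctionSpaces.BesselIRecurrence
import Mathlib.Analysis.Calculus.ParametricIntervalIntegral
import HarnessLib

/-!
# The derivative relation of the modified Bessel functions: `I₀' = I₁`, `I_{n+1}' = (I_n + I_{n+2})/2`

Topic `Literature/Analysis/FunctionSpaces`, a proofs sibling of `BesselMoments.lean` (the tree's
`besselI n x = π⁻¹ ∫₀^π e^{x cos θ} cos(nθ) dθ`, DLMF 10.32.3) and `BesselIRecurrence.lean` (DLMF 10.29.1,
first relation).  This file proves the SECOND relation of DLMF 10.29.1 for integer order,
`I_ν'(z) = (I_{ν−1}(z) + I_{ν+1}(z))/2`, and its `ν = 0` form `I₀'(z) = I₁(z)` (DLMF 10.29.3), for all real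
arguments: differentiate the defining integral under the integral sign (dominated differentiation on `[0, π]`,
the derivative of the integrand being `cos θ e^{x cos θ} cos(nθ)`, bounded by `e^{|x|+1}` near `x`) and use
`2 cos θ cos((n+1)θ) = cos(nθ) + cos((n+2)θ)`.  Everything is proved; no definition and no named fact.

* `hasDerivAt_intervalIntegral_exp_mul_cos_mul_cos` — `d/dx ∫₀^π e^{x cos θ} cos(nθ) dθ = ∫₀^π cos θ e^{x cos θ} cos(nθ) dθ`;
* **`hasDerivAt_besselI_zero`** — `I₀'(x) = I₁(x)`;
* **`hasDerivAt_besselI_succ`** — `I_{n+1}'(x) = (I_n(x) + I_{n+2}(x))/2`;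
* `differentiable_besselI`, `deriv_besselI_zero`, `deriv_besselI_succ`.

## References

* NIST DLMF §10.29.1 (`𝒞_ν'(z) = (𝒞_{ν−1}(z) + 𝒞_{ν+1}(z))/2` for `𝒞 = I`), §10.29.3 (`I₀' = I₁`), §10.32.3. [`DLMF`]
-/

noncomputable section

open Real MeasureTheory intervalIntegral Set

namespace Literature.Analysis.FunctionSpaces

/-- **Differentiating the defining integral under the integral sign**:
`d/dx ∫₀^π e^{x cos θ} cos(nθ) dθ = ∫₀^π cos θ · e^{x cos θ} cos(nθ) dθ`. [cite: DLMF, 10.32.3] -/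
theorem hasDerivAt_intervalIntegral_exp_mul_cos_mul_cos (n : ℕ) (x : ℝ) :
    HasDerivAt (fun y : ℝ => ∫ θ in (0 : ℝ)..π, Real.exp (y * Real.cos θ) * Real.cos (n * θ))
      (∫ θ in (0 : ℝ)..π, Real.cos θ * Real.exp (x * Real.cos θ) * Real.cos (n * θ)) x := by
  have h := intervalIntegral.hasDerivAt_integral_of_dominated_loc_of_deriv_le
    (μ := volume) (a := (0 : ℝ)) (b := π) (x₀ := x) (s := Metric.ball x 1)
    (F := fun (y : ℝ) (θ : ℝ) => Real.exp (y * Real.cos θ) * Real.cos (n * θ))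
    (F' := fun (y : ℝ) (θ : ℝ) => Real.cos θ * Real.exp (y * Real.cos θ) * Real.cos (n * θ))
    (bound := fun _ => Real.exp (|x| + 1)) (Metric.ball_mem_nhds x zero_lt_one)
    (Filter.Eventually.of_forall fun y => (Continuous.aestronglyMeasurable (by fun_prop)))
    ((Continuous.intervalIntegrable (by fun_prop)) _ _)
    (Continuous.aestronglyMeasurable (by fun_prop))
    (Filter.Eventually.of_forall fun θ _ y hy => ?_)
    intervalIntegrable_const
    (Filter.Eventually.of_forall fun θ _ y _ => ?_)
  · exact h.2
  · -- the bound `|cos θ e^{y cos θ} cos(nθ)| ≤ e^{|x|+1}` for `|y − x| < 1`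
    have hy' : |y| ≤ |x| + 1 := by
      have := Metric.mem_ball.mp hy
      rw [Real.dist_eq] at this
      linarith [abs_sub_abs_le_abs_sub y x]
    rw [Real.norm_eq_abs, abs_mul, abs_mul]
    calc |Real.cos θ| * |Real.exp (y * Real.cos θ)| * |Real.cos (n * θ)|
        ≤ 1 * Real.exp (|x| + 1) * 1 := by
          refine mul_le_mul (mul_le_mul (Real.abs_cos_le_one _) ?_ (abs_nonneg _) zero_le_one)
            (Real.abs_cos_le_one _) (abs_nonneg _) (by positivity)
          rw [abs_of_pos (Real.exp_pos _)]
          refine Real.exp_le_exp.2 ((le_abs_self _).trans ?_)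
          rw [abs_mul]
          exact (mul_le_mul_of_nonneg_left (Real.abs_cos_le_one _) (abs_nonneg _)).trans (by linarith)
      _ = Real.exp (|x| + 1) := by ring
  · -- the pointwise derivative in `y`
    have h1 : HasDerivAt (fun y : ℝ => y * Real.cos θ) (Real.cos θ) y := by
      simpa using (hasDerivAt_id y).mul_const (Real.cos θ)
    have h2 := (h1.exp).mul_const (Real.cos (n * θ))
    refine h2.congr_deriv ?_
    ring

/-- `cos θ cos((n+1)θ) = (cos(nθ) + cos((n+2)θ))/2` (product-to-sum, the step behind DLMF 10.29.1). [folklore] -/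
private theorem cos_mul_cos_succ_mul (n : ℕ) (θ : ℝ) :
    Real.cos θ * Real.cos ((n + 1 : ℕ) * θ) = (Real.cos (n * θ) + Real.cos ((n + 2 : ℕ) * θ)) / 2 := by
  have h1 : Real.cos (n * θ) = Real.cos (((n + 1 : ℕ) : ℝ) * θ - θ) := by congr 1; push_cast; ring
  have h2 : Real.cos ((n + 2 : ℕ) * θ) = Real.cos (((n + 1 : ℕ) : ℝ) * θ + θ) := by congr 1; push_cast; ring
  rw [h1, h2, Real.cos_sub, Real.cos_add]
  ring

/-- **`I₀'(x) = I₁(x)`** for every real `x`. [cite: DLMF, 10.29.3] -/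
theorem hasDerivAt_besselI_zero (x : ℝ) : HasDerivAt (besselI 0) (besselI 1 x) x := by
  have h := (hasDerivAt_intervalIntegral_exp_mul_cos_mul_cos 0 x).const_mul π⁻¹
  have hfun : (fun y : ℝ => π⁻¹ * ∫ θ in (0 : ℝ)..π, Real.exp (y * Real.cos θ) * Real.cos ((0 : ℕ) * θ))
      = besselI 0 := by
    funext y; rw [besselI]
  rw [hfun] at h
  refine h.congr_deriv ?_
  rw [besselI]
  congr 1
  refine intervalIntegral.integral_congr fun θ _ => ?_
  simp only [Nat.cast_zero, zero_mul, Real.cos_zero, mul_one, Nat.cast_one, one_mul]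
  ring

/-- **`I_{n+1}'(x) = (I_n(x) + I_{n+2}(x))/2`** for every `n ∈ ℕ` and real `x`. [cite: DLMF, 10.29.1] -/
theorem hasDerivAt_besselI_succ (n : ℕ) (x : ℝ) :
    HasDerivAt (besselI (n + 1)) ((besselI n x + besselI (n + 2) x) / 2) x := by
  have h := (hasDerivAt_intervalIntegral_exp_mul_cos_mul_cos (n + 1) x).const_mul π⁻¹
  have hfun : (fun y : ℝ => π⁻¹ * ∫ θ in (0 : ℝ)..π, Real.exp (y * Real.cos θ) * Real.cos (((n + 1 : ℕ) : ℝ) * θ))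
      = besselI (n + 1) := by
    funext y; rw [besselI]
  rw [hfun] at h
  refine h.congr_deriv ?_
  have hpt : ∀ θ : ℝ, Real.cos θ * Real.exp (x * Real.cos θ) * Real.cos (((n + 1 : ℕ) : ℝ) * θ)
      = (1 / 2 : ℝ) * (Real.exp (x * Real.cos θ) * Real.cos (n * θ)
        + Real.exp (x * Real.cos θ) * Real.cos (((n + 2 : ℕ) : ℝ) * θ)) := by
    intro θ
    rw [mul_comm (Real.cos θ), mul_assoc, cos_mul_cos_succ_mul]
    ring
  simp_rw [hpt]
  rw [intervalIntegral.integral_const_mul,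
    intervalIntegral.integral_add ((Continuous.intervalIntegrable (by fun_prop)) _ _)
      ((Continuous.intervalIntegrable (by fun_prop)) _ _),
    integral_exp_mul_cos_mul_cos_nat, integral_exp_mul_cos_mul_cos_nat]
  field_simp

/-- `I_n` is differentiable on `ℝ` for every `n`. [cite: DLMF, 10.29.1] -/
theorem differentiable_besselI (n : ℕ) : Differentiable ℝ (besselI n) := by
  intro x
  rcases n with _ | n
  · exact (hasDerivAt_besselI_zero x).differentiableAt
  · exact (hasDerivAt_besselI_succ n x).differentiableAt

/-- `deriv I₀ = I₁`. [cite: DLMF, 10.29.3] -/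
theorem deriv_besselI_zero (x : ℝ) : deriv (besselI 0) x = besselI 1 x :=
  (hasDerivAt_besselI_zero x).deriv

/-- `deriv I_{n+1} = (I_n + I_{n+2})/2`. [cite: DLMF, 10.29.1] -/
theorem deriv_besselI_succ (n : ℕ) (x : ℝ) : deriv (besselI (n + 1)) x = (besselI n x + besselI (n + 2) x) / 2 :=
  (hasDerivAt_besselI_succ n x).deriv

/-- **The derivative in `ℤ`-symmetric form**: with `I_m := I_{|m|}`, `d/dx I_{|m|}(x) = (I_{|m−1|}(x) + I_{|m+1|}(x))/2`
for every integer `m` (at `m = 0` this is `I₀' = I₁` since `I_{|−1|} = I₁`). [cite: DLMF, 10.29.1] -/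
theorem hasDerivAt_besselI_natAbs (m : ℤ) (x : ℝ) :
    HasDerivAt (besselI m.natAbs) ((besselI (m - 1).natAbs x + besselI (m + 1).natAbs x) / 2) x := by
  rcases Int.natAbs_eq m with hm | hm
  · -- `m = k ≥ 0`
    rcases h : m.natAbs with _ | k
    · have hm0 : m = 0 := by omega
      subst hm0
      have e1 : ((0 : ℤ) - 1).natAbs = 1 := by decide
      have e2 : ((0 : ℤ) + 1).natAbs = 1 := by decide
      rw [e1, e2]
      simpa using hasDerivAt_besselI_zero x
    · have e1 : (m - 1).natAbs = k := by omega
      have e2 : (m + 1).natAbs = k + 2 := by omega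
      rw [e1, e2]
      exact hasDerivAt_besselI_succ k x
  · -- `m = −k ≤ 0`
    rcases h : m.natAbs with _ | k
    · have hm0 : m = 0 := by omega
      subst hm0
      have e1 : ((0 : ℤ) - 1).natAbs = 1 := by decide
      have e2 : ((0 : ℤ) + 1).natAbs = 1 := by decide
      rw [e1, e2]
      simpa using hasDerivAt_besselI_zero x
    · have e1 : (m - 1).natAbs = k + 2 := by omega
      have e2 : (m + 1).natAbs = k := by omega
      rw [e1, e2, add_comm (besselI (k + 2) x)]
      exact hasDerivAt_besselI_succ k x

end Literature.Analysis.FunctionSpaces
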